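import Summits.QuantumFields.YangMills.Theorems.FradkinShenkerFlowFiniteSusceptibilityWeakCouplingMirrorMonotone
import HarnessLib

/-!
# Bounded axial sums force mirror decorrelation (item stmt-QuantumFields-9442, line `purity-rate-split`)

Support file for item stmt-QuantumFields-9442 (route `FradkinShenkerFlow` of `YangMills`), crux
`Summit.QuantumFields.YangMills.Theses.FradkinShenkerFlow.FiniteSusceptibilityWeakCoupling`, line `purity-rate-split`
(`Cruxes/FiniteSusceptibilityWeakCoupling/Lines/purity_rate_split.lean`), registered stub
`stub_mirrorDecorrelationOfAxialSums`.

Write `L = 2S+1`, `D_A(m) = ⟨A · τ_{m e₀}(A∘Θ)⟩_{β,L} − ⟨A⟩⟨A∘Θ⟩` (the mirror correlator) and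
`D'_A(m) = ⟨(A∘Θ) · τ_{m e₀} A⟩_{β,L} − ⟨A∘Θ⟩⟨A⟩` (the swapped correlator), `R` the time extent of `supp A`.

The landed `MirrorMonotone.mirrorDecorrelation_of_fsClause` derives mirror decorrelation of `A` at `β ≥ 0` from the crux's
susceptibility clause at `β`, but uses that clause ONLY to bound the two axial ℓ¹ norms `Σ_{m ≤ S} |D_A(m)|` and
`Σ_{m ≤ S} |D'_A(m)|` uniformly in `S`. This file isolates the clause-free core: those two bounds ALONE (by a common `χ`)
give, for every `ε > 0`, a `j₀` with `|D_A(j)| ≤ ε` for all `j₀ ≤ j ≤ S` on every odd torus. The argument is verbatim the one of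
`…MirrorMonotone` §2: `E(m) = D_A(m) + D'_A(m)` is non-negative, step-one log-convex and symmetric about `L/2`
(`MirrorLogConvex.mirrorCorr_nonneg/_sq_le/_fold/_fold'`, reflection positivity only), hence non-increasing on `[2R+1, S]`
(`MirrorMonotone.antitone_step_of_logConvex_symm`), so `(j − 2R)·D_A(j) ≤ (j − 2R)·E(j) ≤ Σ_{m ≤ S} E(m) ≤ 2χ` and
`j₀ = 2R + 1 + ⌈2χ/ε⌉ + 1` works. Every compact `G`, every `β ≥ 0`; no definition is introduced; nothing here is a named
fact. References: K. Osterwalder, E. Seiler, Ann. Phys. 110 (1978) 440, §2. [folklore]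
-/

noncomputable section

open MeasureTheory ProbabilityTheory Finset
open Literature.MathematicalPhysics.QuantumFieldTheory hiding Site ZdEdge
open Literature.MathematicalPhysics.QuantumLattice
open Literature.Probability.LatticeModels hiding configShift configShift_apply

namespace Summit.QuantumFields.YangMills.Theorems.FiniteSusceptibilityWeakCoupling

namespace AxialSumsDecorrelation

open MirrorDominationAxis0 MirrorLogConvex MirrorMonotone

variable {G : Type} [Group G] [TopologicalSpace G] [IsTopologicalGroup G] [CompactSpace G]
  [MeasurableSpace G] [BorelSpace G]

/-- **Bounded axial sums of the mirror and swapped correlators imply mirror decorrelation** (every compact `G`, every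
`β ≥ 0`). If `Σ_{m ≤ S} |D_A(m)| ≤ χ₁` and `Σ_{m ≤ S} |D'_A(m)| ≤ χ₂` for all `S`, then for every `ε > 0` there is `j₀` with
`|D_A(j)| ≤ ε` for all `j₀ ≤ j ≤ S`, on EVERY odd torus `2S+1`. Proof: the symmetrised mirror function
`E(m) = D_A(m) + D'_A(m)` is non-negative, step-one log-convex and symmetric about `L/2`, hence non-increasing on
`[2R+1, S]` (`antitone_step_of_logConvex_symm`); so `(j − 2R)·D_A(j) ≤ (j − 2R)·E(j) ≤ χ₁ + χ₂`, and
`j₀ = 2R + 1 + ⌈(χ₁+χ₂)/ε⌉ + 1` works. This is `MirrorMonotone.mirrorDecorrelation_of_fsClause` with its two axial bounds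
taken as hypotheses. [folklore] -/
theorem mirrorDecorrelation_of_axialSums (r : LatticeRep G) {β : ℝ} (hβ : 0 ≤ β) (A : YMSpecies G) {χ₁ χ₂ : ℝ}
    (hax₁ : ∀ S : ℕ, ∑ i ∈ range (S + 1),
      |latticeConnectedCorr r.ρ β (2 * S + 1) A.F (fun V => A.F (cfgReflect V)) i| ≤ χ₁)
    (hax₂ : ∀ S : ℕ, ∑ i ∈ range (S + 1),
      |latticeConnectedCorr r.ρ β (2 * S + 1) (fun V => A.F (cfgReflect V)) A.F i| ≤ χ₂)
    {ε : ℝ} (hε : 0 < ε) :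
    ∃ j₀ : ℕ, ∀ S j : ℕ, j₀ ≤ j → j ≤ S →
      |latticeConnectedCorr r.ρ β (2 * S + 1) A.F (fun V => A.F (cfgReflect V)) j| ≤ ε := by
  -- the time extent `R` of `A` (and of `Aᴿ`)
  obtain ⟨R, hRA, hRA3⟩ : ∃ R : ℕ, (∀ e ∈ A.supp, (e.1 0).natAbs + 2 ≤ R) ∧
      ∀ e ∈ A.supp, (e.1 0).natAbs + (2 + 1) ≤ R := by
    refine ⟨(A.supp.sup fun e => (e.1 0).natAbs) + 3, fun e he => ?_, fun e he => ?_⟩ <;>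
    · have := Finset.le_sup (f := fun e : ZdEdge 4 => (e.1 0).natAbs) he
      omega
  have hRR : ∀ e ∈ (reflSpecies A).supp, (e.1 0).natAbs + 2 ≤ R := radius_reflSpecies A (k := 2) hRA3
  have hχ : 0 ≤ χ₁ + χ₂ := by
    have h1 := (sum_nonneg fun i _ => abs_nonneg _).trans (hax₁ 0)
    have h2 := (sum_nonneg fun i _ => abs_nonneg _).trans (hax₂ 0)
    linarith
  refine ⟨2 * R + 1 + (⌈(χ₁ + χ₂) / ε⌉₊ + 1), fun S j hj hjS => ?_⟩
  -- the symmetrised mirror function on the torus `2S+1`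
  obtain ⟨E, hE⟩ : ∃ E : ℕ → ℝ, ∀ m, E m =
      latticeConnectedCorr r.ρ β (2 * S + 1) A.F (fun V => A.F (cfgReflect V)) m +
        latticeConnectedCorr r.ρ β (2 * S + 1) (fun V => A.F (cfgReflect V)) A.F m := ⟨_, fun _ => rfl⟩
  have h0C : ∀ m, 2 * R + 1 ≤ m → m + 2 * R ≤ 2 * S →
      0 ≤ latticeConnectedCorr r.ρ β (2 * S + 1) A.F (fun V => A.F (cfgReflect V)) m :=
    fun m h1 h2 => mirrorCorr_nonneg r hβ A hRA h1 h2
  have h0C' : ∀ m, 2 * R + 1 ≤ m → m + 2 * R ≤ 2 * S →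
      0 ≤ latticeConnectedCorr r.ρ β (2 * S + 1) (fun V => A.F (cfgReflect V)) A.F m := fun m h1 h2 => by
    rw [← mirrorCorr_reflSpecies]; exact mirrorCorr_nonneg r hβ (reflSpecies A) hRR h1 h2
  have hlC : ∀ m, 2 * R + 2 ≤ m → m + 2 * R + 1 ≤ 2 * S →
      latticeConnectedCorr r.ρ β (2 * S + 1) A.F (fun V => A.F (cfgReflect V)) m ^ 2 ≤
        latticeConnectedCorr r.ρ β (2 * S + 1) A.F (fun V => A.F (cfgReflect V)) (m - 1) *
          latticeConnectedCorr r.ρ β (2 * S + 1) A.F (fun V => A.F (cfgReflect V)) (m + 1) :=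
    fun m h1 h2 => mirrorCorr_sq_le r hβ A hRA h1 h2
  have hlC' : ∀ m, 2 * R + 2 ≤ m → m + 2 * R + 1 ≤ 2 * S →
      latticeConnectedCorr r.ρ β (2 * S + 1) (fun V => A.F (cfgReflect V)) A.F m ^ 2 ≤
        latticeConnectedCorr r.ρ β (2 * S + 1) (fun V => A.F (cfgReflect V)) A.F (m - 1) *
          latticeConnectedCorr r.ρ β (2 * S + 1) (fun V => A.F (cfgReflect V)) A.F (m + 1) :=
    fun m h1 h2 => by
      rw [← mirrorCorr_reflSpecies, ← mirrorCorr_reflSpecies, ← mirrorCorr_reflSpecies]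
      exact mirrorCorr_sq_le r hβ (reflSpecies A) hRR h1 h2
  have h0E : ∀ m, 2 * R + 1 ≤ m → m + (2 * R + 1) ≤ 2 * S + 1 → 0 ≤ E m := fun m h1 h2 => by
    rw [hE]; exact add_nonneg (h0C m h1 (by omega)) (h0C' m h1 (by omega))
  have hlE : ∀ m, 2 * R + 1 < m → m + (2 * R + 1) < 2 * S + 1 → E m ^ 2 ≤ E (m - 1) * E (m + 1) :=
    fun m h1 h2 => by
      rw [hE, hE, hE]
      exact add_sq_le_of_sq_le (hlC m (by omega) (by omega)) (hlC' m (by omega) (by omega))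
        (h0C (m - 1) (by omega) (by omega)) (h0C (m + 1) (by omega) (by omega))
        (h0C' (m - 1) (by omega) (by omega)) (h0C' (m + 1) (by omega) (by omega))
  have hsE : ∀ m, m ≤ 2 * S + 1 → E (2 * S + 1 - m) = E m := fun m hm => by
    rw [hE, hE, mirrorCorr_fold' r β A hm, ← mirrorCorr_fold r β A hm, add_comm]
  -- monotonicity and the tail bound
  have hstep := antitone_step_of_logConvex_symm h0E hlE hsE
  have htail : ((j + 1 - (2 * R + 1) : ℕ) : ℝ) * E j ≤ ∑ i ∈ Ico (2 * R + 1) (j + 1), E i :=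
    card_mul_le_sum_of_le fun i hi hij => le_of_antitone_step hstep hi hij hjS
  have hIco : ∑ i ∈ Ico (2 * R + 1) (j + 1), E i ≤ χ₁ + χ₂ := by
    calc ∑ i ∈ Ico (2 * R + 1) (j + 1), E i
        ≤ ∑ i ∈ Ico (2 * R + 1) (j + 1),
            (|latticeConnectedCorr r.ρ β (2 * S + 1) A.F (fun V => A.F (cfgReflect V)) i| +
              |latticeConnectedCorr r.ρ β (2 * S + 1) (fun V => A.F (cfgReflect V)) A.F i|) :=
          sum_le_sum fun i _ => by rw [hE]; exact add_le_add (le_abs_self _) (le_abs_self _)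
      _ ≤ ∑ i ∈ range (S + 1),
            (|latticeConnectedCorr r.ρ β (2 * S + 1) A.F (fun V => A.F (cfgReflect V)) i| +
              |latticeConnectedCorr r.ρ β (2 * S + 1) (fun V => A.F (cfgReflect V)) A.F i|) := by
          refine sum_le_sum_of_subset_of_nonneg (fun i hi => ?_) (fun i _ _ => by positivity)
          rw [mem_Ico] at hi
          exact mem_range.2 (by omega)
      _ ≤ χ₁ + χ₂ := by rw [sum_add_distrib]; exact add_le_add (hax₁ S) (hax₂ S)
  -- conclusion
  have hEj : E j ≤ ε := by
    have hn : (χ₁ + χ₂) / ε < ((j + 1 - (2 * R + 1) : ℕ) : ℝ) := by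
      have h1 : (χ₁ + χ₂) / ε ≤ ⌈(χ₁ + χ₂) / ε⌉₊ := Nat.le_ceil _
      have h2 : ((⌈(χ₁ + χ₂) / ε⌉₊ : ℕ) : ℝ) + 1 ≤ ((j + 1 - (2 * R + 1) : ℕ) : ℝ) := by
        exact_mod_cast (show ⌈(χ₁ + χ₂) / ε⌉₊ + 1 ≤ j + 1 - (2 * R + 1) by omega)
      linarith
    by_contra hlt
    push Not at hlt
    have h3 : (χ₁ + χ₂) / ε * ε < ((j + 1 - (2 * R + 1) : ℕ) : ℝ) * E j :=
      mul_lt_mul hn hlt.le hε (Nat.cast_nonneg _)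
    rw [div_mul_cancel₀ _ hε.ne'] at h3
    linarith
  have hCj : 0 ≤ latticeConnectedCorr r.ρ β (2 * S + 1) A.F (fun V => A.F (cfgReflect V)) j :=
    h0C j (by omega) (by omega)
  have hC'j : 0 ≤ latticeConnectedCorr r.ρ β (2 * S + 1) (fun V => A.F (cfgReflect V)) A.F j :=
    h0C' j (by omega) (by omega)
  rw [abs_of_nonneg hCj]
  have := hE j
  linarith

end AxialSumsDecorrelation

/-- **Registered sub-goal `stub_mirrorDecorrelationOfAxialSums`** of item stmt-QuantumFields-9442 (signature verbatim):
uniformly bounded axial ℓ¹ norms of the mirror correlator and of the swapped correlator force mirror decorrelation — the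
FS-clause-free core of `MirrorMonotone.mirrorDecorrelation_of_fsClause`: at every `β ≥ 0`, for every compact `G`, every
lattice representation and every gauge-invariant local observable `A`, if `Σ_{m ≤ S} |D_A(m)| ≤ χ` and
`Σ_{m ≤ S} |D'_A(m)| ≤ χ` for all `S` (`D_A` the mirror correlator `⟨A · τ_{m e₀}(A∘Θ)⟩ − ⟨A⟩⟨A∘Θ⟩` on the odd torus `2S+1`,
`D'_A` the swapped one), then for every `ε > 0` there is `j₀` with `|D_A(j)| ≤ ε` for all `j₀ ≤ j ≤ S`, uniformly in `S`
(`AxialSumsDecorrelation.mirrorDecorrelation_of_axialSums` with `χ₁ = χ₂ = χ`; reflection positivity only). [folklore] -/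
theorem stub_mirrorDecorrelationOfAxialSums : ∀ (G : Type) [Group G] [TopologicalSpace G] [IsTopologicalGroup G] [CompactSpace G] [MeasurableSpace G] [BorelSpace G] (r : Literature.MathematicalPhysics.QuantumFieldTheory.LatticeRep G) (β : ℝ), 0 ≤ β → ∀ (A : Literature.MathematicalPhysics.QuantumFieldTheory.YMSpecies G) (χ : ℝ), (∀ S : ℕ, ∑ i ∈ Finset.range (S + 1), |Literature.MathematicalPhysics.QuantumFieldTheory.latticeConnectedCorr r.ρ β (2 * S + 1) A.F (fun V => A.F (Literature.MathematicalPhysics.QuantumFieldTheory.cfgReflect V)) i| ≤ χ) → (∀ S : ℕ, ∑ i ∈ Finset.range (S + 1), |Literature.MathematicalPhysics.QuantumFieldTheory.latticeConnectedCorr r.ρ β (2 * S + 1) (fun V => A.F (Literature.MathematicalPhysics.QuantumFieldTheory.cfgReflect V)) A.F i| ≤ χ) → ∀ ε : ℝ, 0 < ε → ∃ j₀ : ℕ, ∀ S j : ℕ, j₀ ≤ j → j ≤ S → |Literature.MathematicalPhysics.QuantumFieldTheory.latticeConnectedCorr r.ρ β (2 * S + 1) A.F (fun V => A.F (Literature.MathematicalPhysics.QuantumFieldTheory.cfgReflect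 V)) j| ≤ ε :=
  fun _G _ _ _ _ _ _ r _β hβ A _χ hax₁ hax₂ _ε hε =>
    AxialSumsDecorrelation.mirrorDecorrelation_of_axialSums r hβ A hax₁ hax₂ hε

end Summit.QuantumFields.YangMills.Theorems.FiniteSusceptibilityWeakCoupling

end
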